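import Mathlib
import HarnessLib

/-!
# `NoHeavyLowerTail` (stmt-CriticalPhenomena-4575) — capacities of the class-words of the charging scheme (U1-PROOF.md §1, §3, §6, §7; blueprint B5)

Support file (prover `prim-gen-swap` gen 13; `--supports stmt-CriticalPhenomena-4575`).  No definitions, no named facts, no sorries.

Pure real inequalities: the "standard evaluations" of U1-PROOF.md L1.3/L1.4 for the word families used by the charging scheme, from the abstract
class-odds hypotheses of LEAN-BLUEPRINT-U1.md §B — complementary designations `O_{X,P}·O_{X,P'} ≥ Φ_X²`, `Φ_X ≥ 4θ_X`, `Φ_X² ≥ θ_X`, single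
designations `O_{X,d} ≥ θ_X` (from `θ_X ≤ (1−θ_X)O_{X,d}`), dominance `θ_N ≥ θ_X` — to the constants of the ledger (§9):
regular triple / A1–A2 balanced pair `8 θ_Xθ_Y` (margin 8), W-F rider word `32 θ_Xθ_Yθ_J` (two designations complementary on X and Y, constant
on J; replaces the memo's cube-root family bound 48), W_bal word `2 θ_Xθ_J`, W-C rider word `8 θ_Xθ_μθ_J`, open triple `128 θθθ` is
`triangle_word_cap_ge` (…StarSetLoadTriangle).

* `StarSet.odds_ge_theta` — `θ ≤ (1−θ)O`, `0 ≤ θ`, `0 ≤ O` ⇒ `θ ≤ O`;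
* `StarSet.phi_mul_phi_ge_theta` — `Φ_X² ≥ θ_X`, `Φ_N² ≥ θ_N ≥ θ_X ≥ 0`, `Φ ≥ 0` ⇒ `θ_X ≤ Φ_XΦ_N`;
* `StarSet.balanced_word_cap_ge` — `8 θ_Xθ_Y ≤ O_XO_YO_N + O_X'O_Y'O_N'` (A1/A2 words, regular triples);
* `StarSet.riderF_word_cap_ge` — `32 θ_Xθ_Yθ_J ≤ O_XO_YO_J + O_X'O_Y'O_J` (W-F rider words);
* `StarSet.bal_word_cap_ge` — `2 θ_Xθ_J ≤ O_XO_NO_J + O_X'O_N'O_J` (W_bal words);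
* `StarSet.riderC_word_cap_ge` — `8 θ_Xθ_μθ_J ≤ O_XO_μO_J + O_XO_μO_J'` (W-C rider words).
-/

namespace Summit.CriticalPhenomena.PercolationContinuityZ3.Theorems

open Finset
open scoped BigOperators

namespace StarSet

/-- `θ ≤ (1−θ)·O` with `θ, O ≥ 0` gives `θ ≤ O` (single designations: `O_{X,d} ≥ t_X ≥ θ_X`). -/
theorem odds_ge_theta (θ O : ℝ) (hθ : 0 ≤ θ) (hO : 0 ≤ O) (h : θ ≤ (1 - θ) * O) : θ ≤ O := by
  nlinarith [mul_nonneg hθ hO]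

/-- `Φ_X² ≥ θ_X`, `Φ_N² ≥ θ_N ≥ θ_X ≥ 0`, `Φ_X, Φ_N ≥ 0` ⇒ `θ_X ≤ Φ_XΦ_N` (the dominator step of the "margin 8" evaluation). -/
theorem phi_mul_phi_ge_theta (θX θN ΦX ΦN : ℝ) (hθX : 0 ≤ θX) (hdom : θX ≤ θN) (hΦX0 : 0 ≤ ΦX) (hΦN0 : 0 ≤ ΦN)
    (hX : θX ≤ ΦX ^ 2) (hN : θN ≤ ΦN ^ 2) : θX ≤ ΦX * ΦN := by
  have h1 : θX ^ 2 ≤ (ΦX * ΦN) ^ 2 := by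
    have := mul_le_mul hX (hdom.trans hN) hθX (sq_nonneg _)
    nlinarith
  by_contra hlt
  rw [not_le] at hlt
  have hpos : 0 < θX + ΦX * ΦN := by nlinarith [mul_nonneg hΦX0 hΦN0]
  nlinarith [mul_lt_mul_of_pos_right hlt hpos]

/-- **Regular / A1–A2 words (margin 8; U1-PROOF §3): `8 θ_Xθ_Y ≤ O_XO_YO_N + O_X'O_Y'O_N'`** for two designations complementary on `X, Y, N`,
with `N` dominating `X`. -/
theorem balanced_word_cap_ge (θX θY θN ΦX ΦY ΦN OX OX' OY OY' ON ON' : ℝ)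
    (hθX : 0 ≤ θX) (hθY : 0 ≤ θY) (hdom : θX ≤ θN)
    (hΦX0 : 0 ≤ ΦX) (hΦN0 : 0 ≤ ΦN) (hΦY : 4 * θY ≤ ΦY) (hXsq : θX ≤ ΦX ^ 2) (hNsq : θN ≤ ΦN ^ 2)
    (hOX : 0 ≤ OX) (hOX' : 0 ≤ OX') (hOY : 0 ≤ OY) (hOY' : 0 ≤ OY') (hON : 0 ≤ ON) (hON' : 0 ≤ ON')
    (hX : ΦX ^ 2 ≤ OX * OX') (hY : ΦY ^ 2 ≤ OY * OY') (hN : ΦN ^ 2 ≤ ON * ON') :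
    8 * (θX * θY) ≤ OX * OY * ON + OX' * OY' * ON' := by
  have hΦY0 : 0 ≤ ΦY := by linarith
  have h12 : (ΦX * ΦY) ^ 2 ≤ (OX * OY) * (OX' * OY') := by
    have := mul_le_mul hX hY (sq_nonneg _) (mul_nonneg hOX hOX')
    nlinarith
  have h123 : (ΦX * ΦY * ΦN) ^ 2 ≤ (OX * OY * ON) * (OX' * OY' * ON') := by
    have := mul_le_mul h12 hN (sq_nonneg _) (mul_nonneg (mul_nonneg hOX hOY) (mul_nonneg hOX' hOY'))
    nlinarith
  have hamgm : 2 * (ΦX * ΦY * ΦN) ≤ OX * OY * ON + OX' * OY' * ON' := by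
    nlinarith [sq_nonneg (OX * OY * ON - OX' * OY' * ON'), sq_nonneg (OX * OY * ON + OX' * OY' * ON' - 2 * (ΦX * ΦY * ΦN)),
      mul_nonneg (mul_nonneg hOX hOY) hON, mul_nonneg (mul_nonneg hOX' hOY') hON']
  have hXN : θX ≤ ΦX * ΦN := phi_mul_phi_ge_theta θX θN ΦX ΦN hθX hdom hΦX0 hΦN0 hXsq hNsq
  have h4 : 4 * (θX * θY) ≤ ΦX * ΦY * ΦN := by
    have := mul_le_mul hXN hΦY (by linarith) (mul_nonneg hΦX0 hΦN0)
    nlinarith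
  linarith

/-- **W-F rider words (U1-PROOF §6; constant 32): `32 θ_Xθ_Yθ_J ≤ O_XO_YO_J + O_X'O_Y'O_J`** for two designations complementary on `X` and `Y`
and constant on `J` (port odds `O_J ≥ θ_J`). -/
theorem riderF_word_cap_ge (θX θY θJ ΦX ΦY OX OX' OY OY' OJ : ℝ)
    (hθX : 0 ≤ θX) (hθY : 0 ≤ θY) (hθJ : 0 ≤ θJ) (hΦX : 4 * θX ≤ ΦX) (hΦY : 4 * θY ≤ ΦY)
    (hOX : 0 ≤ OX) (hOX' : 0 ≤ OX') (hOY : 0 ≤ OY) (hOY' : 0 ≤ OY') (hOJ : 0 ≤ OJ) (hJ : θJ ≤ (1 - θJ) * OJ)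
    (hX : ΦX ^ 2 ≤ OX * OX') (hY : ΦY ^ 2 ≤ OY * OY') :
    32 * (θX * θY * θJ) ≤ OX * OY * OJ + OX' * OY' * OJ := by
  have hΦX0 : 0 ≤ ΦX := by linarith
  have hΦY0 : 0 ≤ ΦY := by linarith
  have hOJθ : θJ ≤ OJ := odds_ge_theta θJ OJ hθJ hOJ hJ
  have h12 : (ΦX * ΦY) ^ 2 ≤ (OX * OY) * (OX' * OY') := by
    have := mul_le_mul hX hY (sq_nonneg _) (mul_nonneg hOX hOX')
    nlinarith
  have hamgm : 2 * (ΦX * ΦY) ≤ OX * OY + OX' * OY' := by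
    nlinarith [sq_nonneg (OX * OY - OX' * OY'), sq_nonneg (OX * OY + OX' * OY' - 2 * (ΦX * ΦY)),
      mul_nonneg hOX hOY, mul_nonneg hOX' hOY']
  have h16 : 16 * (θX * θY) ≤ ΦX * ΦY := by
    have := mul_le_mul hΦX hΦY (by linarith) hΦX0
    nlinarith
  have hsum : (OX * OY + OX' * OY') * θJ ≤ (OX * OY + OX' * OY') * OJ :=
    mul_le_mul_of_nonneg_left hOJθ (add_nonneg (mul_nonneg hOX hOY) (mul_nonneg hOX' hOY'))
  nlinarith [mul_le_mul_of_nonneg_right hamgm hθJ, mul_nonneg (mul_nonneg hθX hθY) hθJ]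

/-- **W_bal words (U1-PROOF §7, L7.1; margin 2): `2 θ_Xθ_J ≤ O_XO_NO_J + O_X'O_N'O_J`** for two designations complementary on `X` and on its
dominator `N` (`θ_N ≥ θ_X`) and constant on `J` (`O_J ≥ θ_J`). -/
theorem bal_word_cap_ge (θX θN θJ ΦX ΦN OX OX' ON ON' OJ : ℝ)
    (hθX : 0 ≤ θX) (hθJ : 0 ≤ θJ) (hdom : θX ≤ θN) (hΦX0 : 0 ≤ ΦX) (hΦN0 : 0 ≤ ΦN)
    (hXsq : θX ≤ ΦX ^ 2) (hNsq : θN ≤ ΦN ^ 2)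
    (hOX : 0 ≤ OX) (hOX' : 0 ≤ OX') (hON : 0 ≤ ON) (hON' : 0 ≤ ON') (hOJ : 0 ≤ OJ) (hJ : θJ ≤ (1 - θJ) * OJ)
    (hX : ΦX ^ 2 ≤ OX * OX') (hN : ΦN ^ 2 ≤ ON * ON') :
    2 * (θX * θJ) ≤ OX * ON * OJ + OX' * ON' * OJ := by
  have hOJθ : θJ ≤ OJ := odds_ge_theta θJ OJ hθJ hOJ hJ
  have h12 : (ΦX * ΦN) ^ 2 ≤ (OX * ON) * (OX' * ON') := by
    have := mul_le_mul hX hN (sq_nonneg _) (mul_nonneg hOX hOX')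
    nlinarith
  have hamgm : 2 * (ΦX * ΦN) ≤ OX * ON + OX' * ON' := by
    nlinarith [sq_nonneg (OX * ON - OX' * ON'), sq_nonneg (OX * ON + OX' * ON' - 2 * (ΦX * ΦN)),
      mul_nonneg hOX hON, mul_nonneg hOX' hON']
  have hXN : θX ≤ ΦX * ΦN := phi_mul_phi_ge_theta θX θN ΦX ΦN hθX hdom hΦX0 hΦN0 hXsq hNsq
  have hsum : (OX * ON + OX' * ON') * θJ ≤ (OX * ON + OX' * ON') * OJ :=
    mul_le_mul_of_nonneg_left hOJθ (add_nonneg (mul_nonneg hOX hON) (mul_nonneg hOX' hON'))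
  nlinarith [mul_le_mul_of_nonneg_right hamgm hθJ, mul_nonneg hθX hθJ, mul_le_mul_of_nonneg_right hXN hθJ]

/-- **W-C rider words (U1-PROOF §6; margin 8): `8 θ_Xθ_μθ_J ≤ O_XO_μO_J + O_XO_μO_J'`** for two designations constant on the chords `X, μ`
(`O ≥ θ`) and complementary on `J` (`O_JO_J' ≥ Φ_J²`, `Φ_J ≥ 4θ_J`). -/
theorem riderC_word_cap_ge (θX θμ θJ ΦJ OX Oμ OJ OJ' : ℝ)
    (hθX : 0 ≤ θX) (hθμ : 0 ≤ θμ) (hθJ : 0 ≤ θJ) (hΦJ : 4 * θJ ≤ ΦJ)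
    (hOX : 0 ≤ OX) (hOμ : 0 ≤ Oμ) (hOJ : 0 ≤ OJ) (hOJ' : 0 ≤ OJ')
    (hXo : θX ≤ (1 - θX) * OX) (hμo : θμ ≤ (1 - θμ) * Oμ) (hJ : ΦJ ^ 2 ≤ OJ * OJ') :
    8 * (θX * θμ * θJ) ≤ OX * Oμ * OJ + OX * Oμ * OJ' := by
  have hOXθ : θX ≤ OX := odds_ge_theta θX OX hθX hOX hXo
  have hOμθ : θμ ≤ Oμ := odds_ge_theta θμ Oμ hθμ hOμ hμo
  have hamgm : 2 * ΦJ ≤ OJ + OJ' := by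
    nlinarith [sq_nonneg (OJ - OJ'), sq_nonneg (OJ + OJ' - 2 * ΦJ)]
  have h8 : 8 * θJ ≤ OJ + OJ' := by linarith
  have hXμ : θX * θμ ≤ OX * Oμ := mul_le_mul hOXθ hOμθ hθμ hOX
  have := mul_le_mul hXμ h8 (by linarith) (mul_nonneg hOX hOμ)
  nlinarith

end StarSet

end Summit.CriticalPhenomena.PercolationContinuityZ3.Theorems
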